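import Mathlib
import HarnessLib
import Literature.MathematicalPhysics.QuantumFieldTheory.ConstructiveQFTWave0
import Summits.Ventures.LatticeQCDFlow.Scaling.ConjecturesRepaired
import Summits.Ventures.LatticeQCDFlow.Scaling.ExactTransportSUN

/-!
# LatticeQCDFlow / Scaling — (C2a-R) for `SU(N)`, `N ≥ 2`, `d ≥ 2` (v2.5)

HONEST FRAMING: exact (Metropolis-corrected) sampling algorithms for lattice gauge theory; figures
of merit are autocorrelation/cost numbers at stated couplings and volumes; no continuum-physics
claim.

Venture `LatticeQCDFlow` (cell pub-lqcd), topic `Scaling`, FANOUT row 29 (theory2) — OUR WORK.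
The repaired conjecture item `Conjectures.ExactTransportBiLipschitzR` (volumes `L ≥ 2` only,
`Scaling/ConjecturesRepaired.lean`) holds for `SU(N)`, `N ≥ 2`, `d ≥ 2` with the Hilbert–Schmidt
metric — a one-line consequence of row 30's unrepaired theorem `SUN.exactTransportBiLipschitz`
(`Scaling/ExactTransportSUN.lean`, all `L ≥ 1`).  Nothing is cited as a fact.
-/

namespace Summit.Ventures.LatticeQCDFlow.Theory2.Lattice.SUN

open scoped Matrix.Norms.Frobenius
open MeasureTheory Literature.MathematicalPhysics.QuantumFieldTheory
  Literature.MathematicalPhysics.QuantumLattice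

/-- **(C2a-R) for `SU(N)`, `N ≥ 2`, `d ≥ 2`, Hilbert–Schmidt metric** — from row 30's unrepaired
theorem `SUN.exactTransportBiLipschitz` (`SU(3)`, `d = 4` included). [folklore] -/
theorem exactTransportBiLipschitzR (d N : ℕ) (hd : 2 ≤ d) (hN : 2 ≤ N) :
    @Conjectures.ExactTransportBiLipschitzR d N (Matrix.specialUnitaryGroup (Fin N) ℂ) _
      Subtype.metricSpace isTopologicalGroup_hs compactSpace_hs _ borelSpace_hs
      (fundamentalRep (Fin N)) :=
  @Conjectures.exactTransportBiLipschitzR_of d N (Matrix.specialUnitaryGroup (Fin N) ℂ) _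
    Subtype.metricSpace isTopologicalGroup_hs compactSpace_hs _ borelSpace_hs
    (fundamentalRep (Fin N)) (exactTransportBiLipschitz d N hd hN)

end Summit.Ventures.LatticeQCDFlow.Theory2.Lattice.SUN
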